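import Summits.HubbardSuperconductivity.HubbardSuperconductivity.Theorems.AnisotropyChordTransferFibre3RowDecomposition

/-!
# Route `AnisotropyChord` / H0 rotor rung: PartN37 — the DIAGONAL ROTATION identity (O(L) diagonal row formula for `a(n,n)`)

PORT PartN37 (`…Fibre3KernelWindow`, p739260) types `DiagRotation`:
`2V · a(n,n) = Σ_{p=0}^{2L−1} (1 − cos(2πnp/L)) · Σ_{j=0}^{L−1} 1/(4 − λ − 4 cos(πp/L) cos(π(2j + p mod 2)/L))`.

* `diag_rotation` — the identity PROVED for every `L ≥ 1`, every real `λ` and every `n`, with the parity offset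
  `p mod 2` computed in `ℕ` (`((2 * j + p % 2 : ℕ) : ℝ)`), which is the theory seat's formula (cycle21/calc/diag_row.py).
* LOCATED TYPING SLIP: in the ported `Prop` the subterm `p % 2` is elaborated in `ℝ`, where `%` is the Euclidean-domain
  remainder of a field, `x % y = x − x·y/y`, identically `0` (`Field.mod_eq`); so AS TYPED the inner sum runs over EVEN
  `q = 2j` for every row `p` (`diagRotation_iff_even_rows` records this reading).  That typed reading is a different (and,
  numerically, false for `L ≥ 3`) statement; the repair is the `ℕ`-cast above.  Nothing else of PartN37 is affected.

Proof of `diag_rotation` (pure reindexing, no analysis): write `p = 2s + σ`; the summand of `(s, j, σ)` equals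
`g(k)(1 − cos k·(n,n))` at `k = (s + j + σ, s − j) ∈ (ℤ/L)²` (product-to-sum `4 cos x cos y = 2cos(x+y) + 2cos(x−y)`,
periodicity of `cos` through `ZMod.val`); the substitution `s = u + j` and the two-to-one collapse
`Σ_{σ∈{0,1}} Σ_{j ∈ ℤ/L} h(2j + σ) = 2 Σ_{m ∈ ℤ/L} h(m)` (range `2L` = two copies of `ℤ/L`) give `2 Σ_k g(k)(1 − cos k·(n,n))
= 2V·a(n,n)`.
Prover seat `hubbard-h0-rotor-p3` g2; helper for stmt-HubbardSuperconductivity-19089 (`--supports`, helper class).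
Nothing here proves superconductivity in the Hubbard model; helper lemmas of ONE conditional reduction (rung 19089);
the rotor TARGET as originally worded stays FALSE (g15 verdict).  Mathlib + the tree only; no sorry.
-/

set_option linter.dupNamespace false
set_option autoImplicit false

noncomputable section

open scoped BigOperators
open Complex

namespace Summit.HubbardSuperconductivity.HubbardSuperconductivity.Theorems.AnisotropyChord.Transfer.Fibre3

variable (L : ℕ) [NeZero L]

/-! ## Reindexing tools -/

/-- `Σ_{p < 2N} h(p) = Σ_{s < N} (h(2s) + h(2s+1))`. [folklore] -/
theorem sum_range_two_mul' {M : Type*} [AddCommMonoid M] (h : ℕ → M) (N : ℕ) :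
    ∑ p ∈ Finset.range (2 * N), h p = ∑ s ∈ Finset.range N, (h (2 * s) + h (2 * s + 1)) := by
  induction N with
  | zero => simp
  | succ N ih =>
    rw [show 2 * (N + 1) = 2 * N + 1 + 1 by ring, Finset.sum_range_succ, Finset.sum_range_succ, ih,
      Finset.sum_range_succ, add_assoc]

/-- `cos(2π·val(z)/L) = cos(2π z/L)` for an integer `z` read in `ZMod L`. [folklore] -/
theorem cos_two_pi_val_intCast (z : ℤ) :
    Real.cos (2 * Real.pi * (((z : ZMod L)).val : ℝ) / L) = Real.cos (2 * Real.pi * (z : ℝ) / L) := by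
  have hL : (L : ℝ) ≠ 0 := by exact_mod_cast NeZero.ne L
  have h1 : ((((z : ZMod L)).val : ℕ) : ℤ) = z % (L : ℤ) := ZMod.val_intCast z
  have h2 : (((z : ZMod L)).val : ℝ) = ((z % (L : ℤ) : ℤ) : ℝ) := by
    have := congrArg (fun t : ℤ => (t : ℝ)) h1
    simpa using this
  set w : ℤ := z / (L : ℤ) with hw
  rw [h2, Int.emod_def, ← hw]
  push_cast
  have e : 2 * Real.pi * ((z : ℝ) - (L : ℝ) * (w : ℝ)) / L = 2 * Real.pi * (z : ℝ) / L - (w : ℝ) * (2 * Real.pi) := by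
    field_simp
  rw [e]
  exact Real.cos_sub_int_mul_two_pi _ _

/-- `cos(2π a/L) = cos(2π b/L)` when `a ≡ b (mod L)` (integers). [folklore] -/
theorem cos_two_pi_eq_of_intCast_eq (a b : ℤ) (h : (a : ZMod L) = (b : ZMod L)) :
    Real.cos (2 * Real.pi * (a : ℝ) / L) = Real.cos (2 * Real.pi * (b : ℝ) / L) := by
  rw [← cos_two_pi_val_intCast L a, ← cos_two_pi_val_intCast L b, h]

/-- product to sum: `4 cos x cos y = 2 cos(x+y) + 2 cos(x−y)`. [folklore] -/
theorem four_cos_mul_cos (x y : ℝ) :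
    4 * Real.cos x * Real.cos y = 2 * Real.cos (x + y) + 2 * Real.cos (x - y) := by
  rw [Real.cos_add, Real.cos_sub]; ring

/-- two-to-one collapse of `range 2L` onto `ℤ/L`: `Σ_j h(2j) + Σ_j h(2j+1) = 2 Σ_m h(m)`. [folklore] -/
theorem sum_even_add_sum_odd (h : ZMod L → ℝ) :
    ∑ j : ZMod L, h (2 * j) + ∑ j : ZMod L, h (2 * j + 1) = 2 * ∑ m : ZMod L, h m := by
  have e0 : ∑ j : ZMod L, h (2 * j) = ∑ t ∈ Finset.range L, h ((2 * t : ℕ) : ZMod L) := by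
    rw [← RateLemma.sum_zmod_val L (fun t => h ((2 * t : ℕ) : ZMod L))]
    refine Finset.sum_congr rfl fun j _ => ?_
    push_cast
    rw [ZMod.natCast_zmod_val]
  have e1 : ∑ j : ZMod L, h (2 * j + 1) = ∑ t ∈ Finset.range L, h ((2 * t + 1 : ℕ) : ZMod L) := by
    rw [← RateLemma.sum_zmod_val L (fun t => h ((2 * t + 1 : ℕ) : ZMod L))]
    refine Finset.sum_congr rfl fun j _ => ?_
    push_cast
    rw [ZMod.natCast_zmod_val]
  have e2 : ∑ m : ZMod L, h m = ∑ t ∈ Finset.range L, h ((t : ℕ) : ZMod L) := by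
    rw [← RateLemma.sum_zmod_val L (fun t => h ((t : ℕ) : ZMod L))]
    refine Finset.sum_congr rfl fun j _ => ?_
    rw [ZMod.natCast_zmod_val]
  rw [e0, e1, e2, ← Finset.sum_add_distrib, ← sum_range_two_mul' (fun p => h ((p : ℕ) : ZMod L)) L, two_mul L,
    Finset.sum_range_add, two_mul]
  congr 1
  refine Finset.sum_congr rfl fun t _ => ?_
  push_cast
  rw [ZMod.natCast_self, zero_add]

/-- the rotation collapse for an arbitrary function on momenta:
`Σ_x Σ_y [G(x+y, x−y) + G(x+y+1, x−y)] = 2 Σ_k G(k)` on `(ℤ/L)²`. [folklore] -/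
theorem sum_rotate (G : ZMod L × ZMod L → ℝ) :
    ∑ x : ZMod L, ∑ y : ZMod L, (G (x + y, x - y) + G (x + y + 1, x - y)) = 2 * ∑ k : ZMod L × ZMod L, G k := by
  rw [Finset.sum_comm]
  have shift : ∀ y : ZMod L, ∑ x : ZMod L, (G (x + y, x - y) + G (x + y + 1, x - y))
      = ∑ u : ZMod L, (G (u + 2 * y, u) + G (u + (2 * y + 1), u)) := by
    intro y
    rw [← Equiv.sum_comp (Equiv.addRight y)]
    refine Finset.sum_congr rfl fun u _ => ?_
    simp only [Equiv.coe_addRight, add_sub_cancel_right]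
    ring_nf
  simp_rw [shift]
  rw [Finset.sum_comm]
  have collapse : ∀ u : ZMod L,
      ∑ y : ZMod L, (G (u + 2 * y, u) + G (u + (2 * y + 1), u)) = 2 * ∑ m : ZMod L, G (u + m, u) := by
    intro u
    rw [Finset.sum_add_distrib]
    exact sum_even_add_sum_odd L (fun m => G (u + m, u))
  simp_rw [collapse]
  rw [← Finset.mul_sum]
  congr 1
  have relabel : ∀ u : ZMod L, ∑ m : ZMod L, G (u + m, u) = ∑ k1 : ZMod L, G (k1, u) := by
    intro u
    exact Equiv.sum_comp (Equiv.addLeft u) (fun k1 => G (k1, u))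
  simp_rw [relabel]
  rw [Finset.sum_comm, Fintype.sum_prod_type]

/-- the same collapse with the two families indexed by `range L × range L` through the casts. [folklore] -/
theorem sum_rotate_range (G : ZMod L × ZMod L → ℝ) :
    ∑ s ∈ Finset.range L, (∑ j ∈ Finset.range L, G (((s + j : ℕ) : ZMod L), (s : ZMod L) - (j : ZMod L))
        + ∑ j ∈ Finset.range L, G (((s + j + 1 : ℕ) : ZMod L), (s : ZMod L) - (j : ZMod L)))
      = 2 * ∑ k : ZMod L × ZMod L, G k := by
  rw [← sum_rotate L G, ← RateLemma.sum_zmod_val L (fun s =>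
    (∑ j ∈ Finset.range L, G (((s + j : ℕ) : ZMod L), (s : ZMod L) - (j : ZMod L))
        + ∑ j ∈ Finset.range L, G (((s + j + 1 : ℕ) : ZMod L), (s : ZMod L) - (j : ZMod L))))]
  refine Finset.sum_congr rfl fun x _ => ?_
  rw [← RateLemma.sum_zmod_val L (fun j => G (((x.val + j : ℕ) : ZMod L), (x.val : ZMod L) - (j : ZMod L))),
    ← RateLemma.sum_zmod_val L (fun j => G (((x.val + j + 1 : ℕ) : ZMod L), (x.val : ZMod L) - (j : ZMod L))),
    ← Finset.sum_add_distrib]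
  refine Finset.sum_congr rfl fun y _ => ?_
  simp only [Nat.cast_add, Nat.cast_one, ZMod.natCast_zmod_val]

/-- `2V·a(r) = 2 Σ_k g(k)(1 − Re e^{ik·r})`. [folklore] -/
theorem two_V_aKer (lam2 : ℝ) (r : Tor L) :
    2 * (L : ℝ) ^ 2 * aKer L lam2 r = 2 * ∑ k : Tor L, gres L lam2 k * (1 - (phase L k r).re) := by
  have hL : (L : ℝ) ≠ 0 := by exact_mod_cast NeZero.ne L
  unfold aKer Gres
  simp_rw [phase_zero, Complex.one_re, mul_one, mul_sub, mul_one, Finset.sum_sub_distrib]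
  field_simp

/-! ## The summand of the rotated double sum is the momentum summand -/

/-- `cos(2π val((m : ℕ))/L) = cos(2π m/L)`. [folklore] -/
theorem cos_two_pi_val_natCast (m : ℕ) :
    Real.cos (2 * Real.pi * (((m : ZMod L)).val : ℝ) / L) = Real.cos (2 * Real.pi * (m : ℝ) / L) := by
  have := cos_two_pi_val_intCast L (m : ℤ)
  rwa [Int.cast_natCast, Int.cast_natCast] at this

/-- For naturals `s, j, σ` (row `p = 2s+σ`, column `q = 2j+σ`) the rotated summand is `g(k)(1 − cos k·(n,n))` at
`k = (s + j + σ, s − j)`. [folklore] -/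
theorem diag_summand_eq (lam2 : ℝ) (n p q s j σ : ℕ) (hp : p = 2 * s + σ) (hq : q = 2 * j + σ) :
    (1 - Real.cos (2 * Real.pi * n * (p : ℝ) / L))
        * (1 / (4 - lam2 - 4 * Real.cos (Real.pi * (p : ℝ) / L) * Real.cos (Real.pi * (q : ℝ) / L)))
      = gres L lam2 ((((s + j + σ : ℕ) : ZMod L)), ((s : ZMod L) - (j : ZMod L)))
          * (1 - (phase L ((((s + j + σ : ℕ) : ZMod L)), ((s : ZMod L) - (j : ZMod L)))
                  (((n : ZMod L)), ((n : ZMod L)))).re) := by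
  subst hp hq
  -- the two cosines of `ε(k)`
  have hk1 : Real.cos (2 * Real.pi * ((((s + j + σ : ℕ) : ZMod L)).val : ℝ) / L)
      = Real.cos (2 * Real.pi * ((s + j + σ : ℕ) : ℝ) / L) := cos_two_pi_val_natCast L _
  have hk2 : Real.cos (2 * Real.pi * (((s : ZMod L) - (j : ZMod L)).val : ℝ) / L)
      = Real.cos (2 * Real.pi * ((s : ℝ) - j) / L) := by
    have := cos_two_pi_val_intCast L ((s : ℤ) - j)
    push_cast at this
    exact this
  have hden : 4 - lam2 - 4 * Real.cos (Real.pi * ((2 * s + σ : ℕ) : ℝ) / L)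
        * Real.cos (Real.pi * ((2 * j + σ : ℕ) : ℝ) / L)
      = 2 * epsT L ((((s + j + σ : ℕ) : ZMod L)), ((s : ZMod L) - (j : ZMod L))) - lam2 := by
    unfold epsT
    dsimp only
    rw [hk1, hk2, mul_assoc, ← mul_assoc (4 : ℝ), four_cos_mul_cos]
    push_cast
    rw [show Real.pi * (2 * (s : ℝ) + σ) / L + Real.pi * (2 * (j : ℝ) + σ) / L
        = 2 * Real.pi * ((s : ℝ) + j + σ) / L by ring,
      show Real.pi * (2 * (s : ℝ) + σ) / L - Real.pi * (2 * (j : ℝ) + σ) / L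
        = 2 * Real.pi * ((s : ℝ) - j) / L by ring]
    ring
  -- the numerator is `1 − Re e^{ik·(n,n)}`
  have hnum : Real.cos (2 * Real.pi * n * ((2 * s + σ : ℕ) : ℝ) / L)
      = (phase L ((((s + j + σ : ℕ) : ZMod L)), ((s : ZMod L) - (j : ZMod L)))
          (((n : ZMod L)), ((n : ZMod L)))).re := by
    rw [RateLemma.phase_re]
    dsimp only
    have e := cos_two_pi_eq_of_intCast_eq L ((n * (2 * s + σ) : ℕ) : ℤ)
      (((((s + j + σ : ℕ) : ZMod L)).val * (n : ZMod L).val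
          + ((s : ZMod L) - (j : ZMod L)).val * (n : ZMod L).val : ℕ) : ℤ) (by
        push_cast
        rw [ZMod.natCast_zmod_val, ZMod.natCast_zmod_val, ZMod.natCast_zmod_val]
        ring)
    rw [Int.cast_natCast, Int.cast_natCast] at e
    rw [← e]
    push_cast
    ring_nf
  rw [hden, hnum]
  unfold gres
  split_ifs with h0
  · -- `k = 0`: the phase is `1`, both sides vanish
    rw [h0, phase_zero_left, Complex.one_re]
    ring
  · ring

/-! ## The diagonal rotation identity (parity offset in `ℕ`) -/

/-- **DIAGONAL ROTATION** (PartN37 `DiagRotation` with the parity offset `p mod 2` read in `ℕ`; every `L ≥ 1`, every real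
`λ`, every `n`): `2V · a(n,n;λ) = Σ_{p<2L} (1 − cos(2πnp/L)) · Σ_{j<L} 1/(4 − λ − 4cos(πp/L)cos(π(2j + p mod 2)/L))`.
(At `k` with `2ε(k) = λ` both sides use the same junk value `1/0 = 0`, so no restriction on `λ` is needed.) -/
theorem diag_rotation (lam2 : ℝ) (n : ℕ) :
    2 * (L : ℝ) ^ 2 * aKer L lam2 ((n : ZMod L), (n : ZMod L))
      = ∑ p ∈ Finset.range (2 * L),
          (1 - Real.cos (2 * Real.pi * n * p / L))
            * ∑ j ∈ Finset.range L,
                1 / (4 - lam2 - 4 * Real.cos (Real.pi * p / L) * Real.cos (Real.pi * ((2 * j + p % 2 : ℕ) : ℝ) / L)) := by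
  rw [two_V_aKer, sum_range_two_mul']
  have rowE : ∀ s : ℕ, (1 - Real.cos (2 * Real.pi * n * ((2 * s : ℕ) : ℝ) / L))
      * ∑ j ∈ Finset.range L, 1 / (4 - lam2 - 4 * Real.cos (Real.pi * ((2 * s : ℕ) : ℝ) / L)
          * Real.cos (Real.pi * ((2 * j + 2 * s % 2 : ℕ) : ℝ) / L))
      = ∑ j ∈ Finset.range L, gres L lam2 (((s + j : ℕ) : ZMod L), (s : ZMod L) - (j : ZMod L))
          * (1 - (phase L (((s + j : ℕ) : ZMod L), (s : ZMod L) - (j : ZMod L)) ((n : ZMod L), (n : ZMod L))).re) := by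
    intro s
    rw [Finset.mul_sum]
    refine Finset.sum_congr rfl fun j _ => ?_
    exact diag_summand_eq L lam2 n (2 * s) (2 * j + 2 * s % 2) s j 0 (by omega) (by omega)
  have rowO : ∀ s : ℕ, (1 - Real.cos (2 * Real.pi * n * ((2 * s + 1 : ℕ) : ℝ) / L))
      * ∑ j ∈ Finset.range L, 1 / (4 - lam2 - 4 * Real.cos (Real.pi * ((2 * s + 1 : ℕ) : ℝ) / L)
          * Real.cos (Real.pi * ((2 * j + (2 * s + 1) % 2 : ℕ) : ℝ) / L))
      = ∑ j ∈ Finset.range L, gres L lam2 (((s + j + 1 : ℕ) : ZMod L), (s : ZMod L) - (j : ZMod L))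
          * (1 - (phase L (((s + j + 1 : ℕ) : ZMod L), (s : ZMod L) - (j : ZMod L)) ((n : ZMod L), (n : ZMod L))).re) := by
    intro s
    rw [Finset.mul_sum]
    refine Finset.sum_congr rfl fun j _ => ?_
    exact diag_summand_eq L lam2 n (2 * s + 1) (2 * j + (2 * s + 1) % 2) s j 1 (by omega) (by omega)
  simp_rw [rowE, rowO]
  exact (sum_rotate_range L (fun k => gres L lam2 k * (1 - (phase L k ((n : ZMod L), (n : ZMod L))).re))).symm

/-- the typed `Prop` reads `p % 2` in `ℝ`, where it is `0`: `DiagRotation L` is equivalent to the EVEN-ROWS reading. -/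
theorem diagRotation_iff_even_rows :
    DiagRotation L ↔
      ∀ lam2 : ℝ, 0 < lam2 → lam2 < 2 * eps1 L → ∀ n : ℕ,
        2 * (L : ℝ) ^ 2 * aKer L lam2 ((n : ZMod L), (n : ZMod L))
          = ∑ p ∈ Finset.range (2 * L),
              (1 - Real.cos (2 * Real.pi * n * p / L))
                * ∑ j ∈ Finset.range L,
                    1 / (4 - lam2 - 4 * Real.cos (Real.pi * p / L) * Real.cos (Real.pi * (2 * j) / L)) := by
  unfold DiagRotation
  simp only [Field.mod_eq, mul_div_assoc, div_self (two_ne_zero (α := ℝ)), mul_one, sub_self, add_zero]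

end Summit.HubbardSuperconductivity.HubbardSuperconductivity.Theorems.AnisotropyChord.Transfer.Fibre3

end
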